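import Mathlib
import HarnessLib
import Summits.AtomisticToContinuum.BoseEinsteinCondensation.Theses.GapWindowLadder
import Literature.MathematicalPhysics.QuantumManyBody.BoseGasThermodynamicLimitRuelle

/-!
# Route GapWindowLadder — support item `GapResponseEngine` (stmt-AtomisticToContinuum-27585), BY NAME

decomp-a2c lens-6 g13 (E twin owed since critic row 120). Port of the node kernel
`HOME/decomp-a2c-lens-6/g12/NodeGapWindowLadder.lean §Kernel` (`gapResponseEngine_holds`, 0 sorry) to a
Theorems file with NO foreign `Theses` import and NO new `def` (the node's shorthands `subSum`,
`pairLoss`, `LawAtRate`, … are replaced by abstract quantities `S`, `P`, `Exc` in the helper lemmas and by the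
item's own explicit sums in the closing theorem).

THE ENGINE at box rate: for every `v`, `ρ > 0`, `M > 0`, `M' > 0` — the dilute floor at pivot parameter `M`
(`S_K ≥ 7N/8` for 1-near-minimisers at the healing-pivot levels), loss bookkeeping in the boxes of side `L_N`
(`S_k ≤ S_{k-1} + 16⁻¹ pairloss_k`), the mesoscopic law (level rate `κ₁/ℓ_k²`, rows `≤ 1/16`) and the infrared law
in RESPONSE form at the BOX rate `κ₂/L_N²` (rows `≤ 3/4`) imply `HasGroundStateBEC v ρ` with `c₀ = 1/32`.
Proof: eventually in `N` pick the pivot level `K` (`M/√ρ ≤ ℓ_K < 2M/√ρ`) and the seam level `R`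
(`y ≤ ℓ_R < 2y`, `y⁴ρ³ = M'⁴`), THEN the tolerance `δ_N := min 1 (κN/(32(K+1)L_N²))`, `κ = min κ₁ κ₂`; each law and
`δ_N`-near-minimality give `16⁻¹pairloss_k ≤ δ_N/λ_k + e_k N` with `λ_k ≥ κ/L_N²` (`loss_le_of_law`); bookkeeping
telescopes to `S_K ≤ S_0 + (K·δ_N L_N²/κ + 3/4·N + 1/16·N) ≤ S_0 + 27N/32` (`levels_telescope`); the floor
`S_K ≥ 7N/8` leaves `S_0 ≥ N/32`, and `S_0 ≤ λ_max(γ_Ψ)` (`level_zero_le_maxOccupation`); `le_condensateNumber`.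
-/

noncomputable section

namespace Summit.AtomisticToContinuum.BoseEinsteinCondensation.Theorems.GapWindowLadderEngine

open scoped BigOperators Topology ENNReal NNReal
open Filter MeasureTheory
open Literature.MathematicalPhysics.QuantumManyBody.BoseGas

/-! ## Abstract helpers (pure `ℝ` / `ℝ≥0∞` arithmetic) -/

/-- the box has the largest scale: `ℓ_k = L/2^k ≤ L`, so the box rate is the smallest: `κ/L² ≤ κ/ℓ_k²`. -/
theorem boxRate_le_levelRate {κ L : ℝ} (hκ : 0 ≤ κ) (hL : 0 < L) (k : ℕ) :
    κ / L ^ 2 ≤ κ / (L / 2 ^ k) ^ 2 := by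
  have h1 : L / 2 ^ k ≤ L := div_le_self hL.le (one_le_pow₀ one_le_two)
  have h2 : 0 < L / 2 ^ k := by positivity
  exact div_le_div_of_nonneg_left hκ (by positivity) (by gcongr)

/-- HELLMANN–FEYNMAN TRANSFER at rate `r` (abstract): the law `r·P ≤ Exc + r·a·N` and the excess bound
`Exc ≤ d` give `P ≤ d/r + a·N`. -/
theorem loss_le_of_law {P Exc : ℝ≥0∞} {N : ℕ} {r a d : ℝ} (hr : 0 < r) (ha : 0 ≤ a) (hd : 0 ≤ d)
    (hlaw : ENNReal.ofReal r * P ≤ Exc + ENNReal.ofReal (r * a * N)) (hexc : Exc ≤ ENNReal.ofReal d) :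
    P ≤ ENNReal.ofReal (d / r + a * N) := by
  have hpos : 0 ≤ r * a * N := by positivity
  have h2 : ENNReal.ofReal r * P ≤ ENNReal.ofReal (d + r * a * N) := by
    rw [ENNReal.ofReal_add hd hpos]
    exact hlaw.trans (add_le_add hexc le_rfl)
  have hX : P ≤ ENNReal.ofReal (d + r * a * N) / ENNReal.ofReal r := by
    rw [ENNReal.le_div_iff_mul_le (Or.inl (ENNReal.ofReal_pos.2 hr).ne') (Or.inl ENNReal.ofReal_ne_top),
      mul_comm]
    exact h2
  calc P ≤ _ := hX
    _ = ENNReal.ofReal ((d + r * a * N) / r) := (ENNReal.ofReal_div_of_pos hr).symm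
    _ = ENNReal.ofReal (d / r + a * N) := by rw [add_div, mul_assoc, mul_div_cancel_left₀ _ hr.ne']

/-- telescoping a per-level recursion `S k ≤ S (k-1) + ofReal (t k)` over `1 ≤ k ≤ K`. -/
theorem telescope_le {S : ℕ → ℝ≥0∞} {t : ℕ → ℝ} (ht : ∀ k, 0 ≤ t k) {K : ℕ}
    (hstep : ∀ k, 1 ≤ k → k ≤ K → S k ≤ S (k - 1) + ENNReal.ofReal (t k)) :
    S K ≤ S 0 + ENNReal.ofReal (∑ k ∈ Finset.Ico 1 (K + 1), t k) := by
  have key : ∀ m, m ≤ K → S m ≤ S 0 + ENNReal.ofReal (∑ k ∈ Finset.Ico 1 (m + 1), t k) := by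
    intro m
    induction m with
    | zero => intro _; exact le_self_add
    | succ m ih =>
      intro hm
      have h1 := ih (Nat.le_of_succ_le hm)
      have h2 := hstep (m + 1) (Nat.succ_le_succ (Nat.zero_le _)) hm
      simp only [Nat.add_sub_cancel] at h2
      calc S (m + 1) ≤ S m + ENNReal.ofReal (t (m + 1)) := h2
        _ ≤ S 0 + ENNReal.ofReal (∑ k ∈ Finset.Ico 1 (m + 1), t k) + ENNReal.ofReal (t (m + 1)) :=
          add_le_add h1 le_rfl
        _ = S 0 + ENNReal.ofReal (∑ k ∈ Finset.Ico 1 (m + 1 + 1), t k) := by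
          rw [Finset.sum_Ico_succ_top (by omega : 1 ≤ m + 1),
            ENNReal.ofReal_add (Finset.sum_nonneg fun k _ => ht k) (ht _), add_assoc]
  exact key K le_rfl

/-- THE DETERMINISTIC MIDDLE at box rate (abstract in the level sums `S k`, the losses `P k` and the excess
`Exc ≤ d`): the laws at levels `1 … K` (box-rate infrared law for `k ≤ R`, level-rate mesoscopic law for
`R < k ≤ K`, where `ℓ_R < 2y`, `y⁴ρ³ = M'⁴`) and bookkeeping give `S_K ≤ S_0 + (27/32)·N`, provided
`d·K·L² ≤ min(κ₁,κ₂)·N/32`. -/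
theorem levels_telescope {S P : ℕ → ℝ≥0∞} {Exc : ℝ≥0∞} {L ρ M' y : ℝ} {N K R : ℕ} {κ₁ κ₂ d : ℝ}
    {e₁ e₂ : ℕ → ℕ → ℝ} (hL : 0 < L) (hρ : 0 < ρ) (hNr : (0 : ℝ) < N) (hκ₁ : 0 < κ₁) (hκ₂ : 0 < κ₂)
    (he₁ : ∀ K k : ℕ, 0 ≤ e₁ K k) (hb₁ : ∀ K : ℕ, ∑ k ∈ Finset.range (K + 1), e₁ K k ≤ 1 / 16)
    (he₂ : ∀ K k : ℕ, 0 ≤ e₂ K k) (hb₂ : ∀ K : ℕ, ∑ k ∈ Finset.range (K + 1), e₂ K k ≤ 3 / 4)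
    (hy4 : y ^ 4 * ρ ^ 3 = M' ^ 4) (hd : 0 < d) (hd2 : d * K * L ^ 2 ≤ min κ₁ κ₂ * N / 32)
    (hbook : ∀ k : ℕ, 1 ≤ k → k ≤ K → S k ≤ S (k - 1) + P k) (hExc : Exc ≤ ENNReal.ofReal d)
    (hR2 : L / 2 ^ R < 2 * y)
    (hMeso : ∀ k : ℕ, 1 ≤ k → k ≤ K → (L / 2 ^ k) ^ 4 * ρ ^ 3 < M' ^ 4 →
      ENNReal.ofReal (κ₁ / (L / 2 ^ k) ^ 2) * P k ≤ Exc + ENNReal.ofReal (κ₁ / (L / 2 ^ k) ^ 2 * e₁ K k * N))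
    (hInfra : ∀ k : ℕ, 1 ≤ k → k ≤ R →
      ENNReal.ofReal (κ₂ / L ^ 2) * P k ≤ Exc + ENNReal.ofReal (κ₂ / L ^ 2 * e₂ R k * N)) :
    S K ≤ S 0 + ENNReal.ofReal (27 / 32 * N) := by
  set κ := min κ₁ κ₂ with hκdef
  have hκ : 0 < κ := lt_min hκ₁ hκ₂
  -- per-level allowance and rate: box-rate infrared law for `k ≤ R`, level-rate mesoscopic law for `R < k ≤ K`
  obtain ⟨a, ha_def⟩ : ∃ a : ℕ → ℝ, a = fun k => if k ≤ R then e₂ R k else e₁ K k := ⟨_, rfl⟩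
  obtain ⟨lam, hlam_def⟩ : ∃ lam : ℕ → ℝ,
      lam = fun k => if k ≤ R then κ₂ / L ^ 2 else κ₁ / (L / 2 ^ k) ^ 2 := ⟨_, rfl⟩
  have ha0 : ∀ k, 0 ≤ a k := fun k => by
    rw [ha_def]; dsimp only; split_ifs; exacts [he₂ R k, he₁ K k]
  have hlam0 : ∀ k, κ / L ^ 2 ≤ lam k := fun k => by
    rw [hlam_def]; dsimp only; split_ifs
    · exact div_le_div_of_nonneg_right (min_le_right _ _) (by positivity)
    · exact (div_le_div_of_nonneg_right (min_le_left _ _) (by positivity)).trans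
        (boxRate_le_levelRate hκ₁.le hL k)
  have hlampos : ∀ k, 0 < lam k := fun k => lt_of_lt_of_le (by positivity) (hlam0 k)
  have hstep : ∀ k, 1 ≤ k → k ≤ K → S k ≤ S (k - 1) + ENNReal.ofReal (d / lam k + a k * N) := by
    intro k hk1 hkK
    have hb := hbook k hk1 hkK
    by_cases hkR : k ≤ R
    · have h := loss_le_of_law (by positivity : 0 < κ₂ / L ^ 2) (he₂ R k) hd.le (hInfra k hk1 hkR) hExc
      have e1 : a k = e₂ R k := by rw [ha_def]; dsimp only; rw [if_pos hkR]
      have e2 : lam k = κ₂ / L ^ 2 := by rw [hlam_def]; dsimp only; rw [if_pos hkR]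
      rw [e1, e2]
      exact hb.trans (add_le_add le_rfl h)
    · have hkR' : R + 1 ≤ k := by omega
      have hy : 0 < y := by
        have h0 : 0 ≤ L / 2 ^ R := by positivity
        linarith
      have hsmall : (L / 2 ^ k) ^ 4 * ρ ^ 3 < M' ^ 4 := by
        have h1 : L / 2 ^ k ≤ L / 2 ^ (R + 1) :=
          div_le_div_of_nonneg_left hL.le (by positivity) (pow_le_pow_right₀ one_le_two hkR')
        have h2 : L / 2 ^ (R + 1) < y := by
          rw [pow_succ, ← div_div, div_lt_iff₀ (by norm_num : (0 : ℝ) < 2)]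
          linarith [hR2]
        have h3 : L / 2 ^ k < y := lt_of_le_of_lt h1 h2
        have h4 : 0 ≤ L / 2 ^ k := by positivity
        calc (L / 2 ^ k) ^ 4 * ρ ^ 3 < y ^ 4 * ρ ^ 3 := by gcongr
          _ = M' ^ 4 := hy4
      have h := loss_le_of_law (by positivity : 0 < κ₁ / (L / 2 ^ k) ^ 2) (he₁ K k) hd.le
        (hMeso k hk1 hkK hsmall) hExc
      have e1 : a k = e₁ K k := by rw [ha_def]; dsimp only; rw [if_neg hkR]
      have e2 : lam k = κ₁ / (L / 2 ^ k) ^ 2 := by rw [hlam_def]; dsimp only; rw [if_neg hkR]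
      rw [e1, e2]
      exact hb.trans (add_le_add le_rfl h)
  have htel := telescope_le (S := S) (t := fun k => d / lam k + a k * N)
    (fun k => by have := ha0 k; have := hlampos k; positivity) hstep
  -- the budget: allowances `3/4 + 1/16`
  have hsumA : ∑ k ∈ Finset.Ico 1 (K + 1), a k * N ≤ (3 / 4 + 1 / 16) * N := by
    rw [← Finset.sum_mul]
    refine mul_le_mul_of_nonneg_right ?_ hNr.le
    rw [ha_def]; dsimp only
    rw [Finset.sum_ite]
    refine add_le_add ?_ ?_
    · calc ∑ k ∈ (Finset.Ico 1 (K + 1)).filter (fun k => k ≤ R), e₂ R k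
          ≤ ∑ k ∈ Finset.range (R + 1), e₂ R k :=
            Finset.sum_le_sum_of_subset_of_nonneg (fun k hk => by
              simp only [Finset.mem_filter, Finset.mem_Ico, Finset.mem_range] at hk ⊢; omega)
              (fun k _ _ => he₂ R k)
        _ ≤ 3 / 4 := hb₂ R
    · calc ∑ k ∈ (Finset.Ico 1 (K + 1)).filter (fun k => ¬k ≤ R), e₁ K k
          ≤ ∑ k ∈ Finset.range (K + 1), e₁ K k :=
            Finset.sum_le_sum_of_subset_of_nonneg (fun k hk => by
              simp only [Finset.mem_filter, Finset.mem_Ico, Finset.mem_range] at hk ⊢; omega)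
              (fun k _ _ => he₁ K k)
        _ ≤ 1 / 16 := hb₁ K
  -- the budget: slack `Σ_k d/λ_k ≤ K·dL²/κ ≤ N/32` (every rate is at least the box rate `κ/L²`)
  have hsumD : ∑ k ∈ Finset.Ico 1 (K + 1), d / lam k ≤ 1 / 32 * N := by
    have hterm : ∀ k ∈ Finset.Ico 1 (K + 1), d / lam k ≤ d * L ^ 2 / κ := by
      intro k _
      have h1 : d / lam k ≤ d / (κ / L ^ 2) :=
        div_le_div_of_nonneg_left hd.le (by positivity) (hlam0 k)
      rw [div_div_eq_mul_div] at h1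
      exact h1
    calc ∑ k ∈ Finset.Ico 1 (K + 1), d / lam k
        ≤ ∑ k ∈ Finset.Ico 1 (K + 1), d * L ^ 2 / κ := Finset.sum_le_sum hterm
      _ = K * (d * L ^ 2 / κ) := by
          rw [Finset.sum_const, Nat.card_Ico, nsmul_eq_mul]; norm_num
      _ = d * K * L ^ 2 / κ := by ring
      _ ≤ κ * N / 32 / κ := div_le_div_of_nonneg_right hd2 hκ.le
      _ = 1 / 32 * N := by
          rw [show κ * N / 32 / κ = κ / κ * (1 / 32 * N) by ring, div_self hκ.ne', one_mul]
  have hsum : ∑ k ∈ Finset.Ico 1 (K + 1), (d / lam k + a k * N) ≤ 27 / 32 * N := by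
    rw [Finset.sum_add_distrib]; linarith [hsumA, hsumD]
  exact htel.trans (add_le_add le_rfl (ENNReal.ofReal_le_ofReal hsum))

/-! ## Level 0 and the scale `y` -/

/-- **Level 0**: the single sub-cell mode of `[0,L)³` is a test mode for `λ_max`, so `S_0 ≤ λ_max(γ_Ψ)`. -/
theorem level_zero_le_maxOccupation {N : ℕ} {L : ℝ} (hL : 0 < L) (Ψ : Config N → ℂ) :
    ∑ q : SubIdx (2 ^ 0), occupation N (subMode (L / 2 ^ 0) q) Ψ ≤ maxOccupation N Ψ := by
  have hℓ : 0 < L / 2 ^ 0 := by positivity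
  calc ∑ q : SubIdx (2 ^ 0), occupation N (subMode (L / 2 ^ 0) q) Ψ
      ≤ ∑ _q : SubIdx (2 ^ 0), maxOccupation N Ψ :=
        Finset.sum_le_sum fun q _ =>
          occupation_le_maxOccupation Ψ (aestronglyMeasurable_subMode _ q) (lintegral_subMode_sq hℓ q)
    _ = maxOccupation N Ψ := by
        rw [Finset.sum_const, Finset.card_univ]
        have : Fintype.card (SubIdx (2 ^ 0)) = 1 := by simp [SubIdx]
        rw [this, one_smul]

/-- the infrared window scale `y = M' ρ^{-3/4}`, typed polynomially: `y > 0` with `y⁴ρ³ = M'⁴`. -/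
theorem exists_seam_scale {ρ M' : ℝ} (hρ : 0 < ρ) (hM' : 0 < M') :
    ∃ y : ℝ, 0 < y ∧ y ^ 4 * ρ ^ 3 = M' ^ 4 := by
  refine ⟨Real.sqrt (Real.sqrt (M' ^ 4 / ρ ^ 3)), by positivity, ?_⟩
  have h1 : (Real.sqrt (Real.sqrt (M' ^ 4 / ρ ^ 3))) ^ 4 = M' ^ 4 / ρ ^ 3 := by
    rw [show (4 : ℕ) = 2 * 2 by norm_num, pow_mul, Real.sq_sqrt (Real.sqrt_nonneg _),
      Real.sq_sqrt (by positivity)]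
  rw [h1, div_mul_cancel₀ _ (by positivity)]

/-- a dyadic level `ℓ_K = L/2^K` of the box of side `L` inside any window `[y, 2y)` with `0 < y ≤ L`
(stated with the level as the witness of an `∃` over `ℓ`, so the lemma is about the box scale only). -/
theorem exists_dyadic_level {y L : ℝ} (hy : 0 < y) (hyL : y ≤ L) :
    ∃ K : ℕ, y ≤ L / 2 ^ K ∧ L / 2 ^ K / 2 < y := by
  have hx : 1 ≤ L / y := by rw [le_div_iff₀ hy, one_mul]; exact hyL
  obtain ⟨K, hK1, hK2⟩ := exists_nat_pow_near hx one_lt_two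
  have h2K : (0 : ℝ) < 2 ^ K := by positivity
  refine ⟨K, ?_, ?_⟩
  · rw [le_div_iff₀ h2K]
    have h := (le_div_iff₀ hy).1 hK1
    linarith
  · rw [div_div, div_lt_iff₀ (by positivity)]
    have h := (div_lt_iff₀ hy).1 hK2
    calc L < 2 ^ (K + 1) * y := h
      _ = y * (2 ^ K * 2) := by rw [pow_succ]; ring

/-! ## The item, by name -/

/-- **`GapResponseEngine` holds** (route GapWindowLadder, item stmt-AtomisticToContinuum-27585):
floor + bookkeeping + mesoscopic law + box-rate infrared response law ⇒ `HasGroundStateBEC v ρ`, `c₀ = 1/32`. -/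
theorem gapResponseEngine :
    Summit.AtomisticToContinuum.BoseEinsteinCondensation.Theses.GapWindowLadder.GapResponseEngine := by
  intro v ρ M M' hρ hM hM' hF hB hMe hI
  obtain ⟨κ₁, hκ₁, e₁, he₁, hb₁, H₁⟩ := hMe
  obtain ⟨κ₂, hκ₂, e₂, he₂, hb₂, H₂⟩ := hI
  obtain ⟨y, hy, hy4⟩ := exists_seam_scale hρ hM'
  refine ⟨1 / 32, by norm_num, ?_⟩
  have hLev₁ : ∀ᶠ N : ℕ in atTop, M / Real.sqrt ρ ≤ sideLength ρ N :=
    (tendsto_sideLength_atTop hρ).eventually_ge_atTop _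
  have hLev₂ : ∀ᶠ N : ℕ in atTop, y ≤ sideLength ρ N :=
    (tendsto_sideLength_atTop hρ).eventually_ge_atTop _
  filter_upwards [hF, H₁, H₂, hLev₁, hLev₂, eventually_gt_atTop 0] with N hFN h₁N h₂N hL₁ hL₂ hNpos
  set L := sideLength ρ N with hLdef
  have hL : 0 < L := sideLength_pos_of_pos hρ hNpos
  have hNr : (0 : ℝ) < N := by exact_mod_cast hNpos
  set κ := min κ₁ κ₂ with hκdef
  have hκ : 0 < κ := lt_min hκ₁ hκ₂
  -- the two pivots FIRST: healing `K` and infrared `R`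
  obtain ⟨K, hK1, hK2'⟩ := exists_dyadic_level (by positivity : (0 : ℝ) < M / Real.sqrt ρ) hL₁
  have hK2 : L / 2 ^ K < 2 * (M / Real.sqrt ρ) := by linarith
  obtain ⟨R, hR1, hR2'⟩ := exists_dyadic_level hy hL₂
  have hR2 : L / 2 ^ R < 2 * y := by linarith
  -- then the tolerance, small enough for the `K` levels at box rate
  set d : ℝ := min 1 (κ * N / (32 * (K + 1) * L ^ 2)) with hd_def
  have hd : 0 < d := lt_min one_pos (by positivity)
  have hd1 : d ≤ 1 := min_le_left _ _
  have hd2 : d * K * L ^ 2 ≤ κ * N / 32 := by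
    have h1 : d ≤ κ * N / (32 * (K + 1) * L ^ 2) := min_le_right _ _
    have hK0 : (K : ℝ) ≤ K + 1 := by linarith
    calc d * K * L ^ 2 ≤ d * (K + 1) * L ^ 2 := by gcongr
      _ ≤ κ * N / (32 * (K + 1) * L ^ 2) * (K + 1) * L ^ 2 := by gcongr
      _ = κ * N / 32 := by field_simp
  refine le_condensateNumber v (δ := ENNReal.ofReal d) (ENNReal.ofReal_pos.2 hd) fun Ψ hΨ => ?_
  have hΨ₁ : energy v Ψ ≤ groundStateEnergy v N L + 1 :=
    hΨ.trans (add_le_add le_rfl (ENNReal.ofReal_le_one.2 hd1))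
  have hExc : energy v Ψ - groundStateEnergy v N L ≤ ENNReal.ofReal d :=
    tsub_le_iff_right.2 (hΨ.trans_eq (add_comm _ _))
  have hLR : 0 ≤ L / 2 ^ R := by positivity
  have hR1' : M' ^ 4 ≤ (L / 2 ^ R) ^ 4 * ρ ^ 3 := by
    rw [← hy4]; gcongr
  have hR2'' : (L / 2 ^ R) ^ 4 * ρ ^ 3 < 16 * M' ^ 4 := by
    calc (L / 2 ^ R) ^ 4 * ρ ^ 3 < (2 * y) ^ 4 * ρ ^ 3 := by gcongr
      _ = 16 * M' ^ 4 := by rw [← hy4]; ring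
  -- the level sums `S k` and the losses `P k` of `Ψ`
  obtain ⟨S, hS⟩ : ∃ S : ℕ → ℝ≥0∞, S = fun k => ∑ q : SubIdx (2 ^ k), occupation N (subMode (L / 2 ^ k) q) Ψ.ψ :=
    ⟨_, rfl⟩
  obtain ⟨P, hP⟩ : ∃ P : ℕ → ℝ≥0∞, P = fun k => (16 : ENNReal)⁻¹ * ∑ c : SubIdx (2 ^ k),
      ∑ c' ∈ Finset.univ.filter (fun c' : SubIdx (2 ^ k) => c ≠ c' ∧ ∀ j : Fin 3, (c j : ℕ) / 2 = (c' j : ℕ) / 2),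
        occupation N (fun x => subMode (L / 2 ^ k) c x - subMode (L / 2 ^ k) c' x) Ψ.ψ := ⟨_, rfl⟩
  have hfloor : ENNReal.ofReal (7 * (N : ℝ) / 8) ≤ S K := by
    rw [hS]; exact hFN Ψ hΨ₁ K hK1 hK2
  have hbook : ∀ k : ℕ, 1 ≤ k → k ≤ K → S k ≤ S (k - 1) + P k := by
    intro k hk _
    rw [hS, hP]
    exact (hB N hL Ψ k hk).1
  have hMeso : ∀ k : ℕ, 1 ≤ k → k ≤ K → (L / 2 ^ k) ^ 4 * ρ ^ 3 < M' ^ 4 →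
      ENNReal.ofReal (κ₁ / (L / 2 ^ k) ^ 2) * P k ≤
        (energy v Ψ - groundStateEnergy v N L) + ENNReal.ofReal (κ₁ / (L / 2 ^ k) ^ 2 * e₁ K k * N) := by
    intro k hk hkK hs
    rw [hP]
    exact h₁N K k hK1 hK2 hk hkK hs Ψ
  have hInfra : ∀ k : ℕ, 1 ≤ k → k ≤ R →
      ENNReal.ofReal (κ₂ / L ^ 2) * P k ≤
        (energy v Ψ - groundStateEnergy v N L) + ENNReal.ofReal (κ₂ / L ^ 2 * e₂ R k * N) := by
    intro k hk hkR
    rw [hP]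
    exact h₂N R k hR1' hR2'' hk hkR Ψ
  have hmid : S K ≤ S 0 + ENNReal.ofReal (27 / 32 * N) :=
    levels_telescope hL hρ hNr hκ₁ hκ₂ he₁ hb₁ he₂ hb₂ hy4 hd hd2 hbook hExc hR2 hMeso hInfra
  have h0 : ENNReal.ofReal (1 / 32 * N) ≤ S 0 := by
    have h2 := tsub_le_iff_right.2 (hfloor.trans hmid)
    calc ENNReal.ofReal (1 / 32 * N) = ENNReal.ofReal (7 * (N : ℝ) / 8 - 27 / 32 * N) := by
          congr 1; ring
      _ = ENNReal.ofReal (7 * (N : ℝ) / 8) - ENNReal.ofReal (27 / 32 * N) :=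
          ENNReal.ofReal_sub _ (by positivity)
      _ ≤ S 0 := h2
  have h00 : S 0 ≤ maxOccupation N Ψ.ψ := by
    rw [hS]; exact level_zero_le_maxOccupation hL Ψ.ψ
  exact h0.trans h00

end Summit.AtomisticToContinuum.BoseEinsteinCondensation.Theorems.GapWindowLadderEngine

end
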